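import Literature.NumberTheory.Transcendental.KZSemiCanonicalReductionProofs
import Summits.KontsevichZagierPeriods.KontsevichZagierPeriods.Theorems.AbelContractionRealHyperellipticSectorBudgetKit

/-!
# Route AbelContraction — `RealHyperellipticSector` (crux stmt-KontsevichZagierPeriods-12475):
# the dimension-certified port — compactification of the domain inside a budget

Helper file of the line `Lines/birth.lean` (stub `stub_bakerAlg`, `--supports` the crux): the
budget forms (`KZ.relationsLE d`, all representations of dimension `k ≤ d`) of the generalities of
`Literature/NumberTheory/Transcendental/KZSemiCanonicalReductionProofs.lean` which the top of the
port (`…PortDimOneAssembly.lean`) calls: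

* `Kit.sum_sub_sum_mem_relationsLE` — termwise finite sums;
* `Kit.of_sub_of_mem_relationsLE_of_null` — null modifications (rule 1a);
* `Kit.of_sub_sum_of_mem_relationsLE` — iterated domain additivity over a finite almost-partition
  (rule 1a);
* `Kit.exists_sub_sum_bounded_mem_relationsLE` (registered sub-goal) — **step (a) of Viu-Sos's
  semi-canonical reduction at the level of moves, inside the budget**: a representation of KZ's
  rational shape of dimension `k ≤ d` differs by a TRUNCATED relation of `relationsLE d` from the
  sum of the `2ᵏ` rational representations on the bounded pieces `pieceDom T σ ⊆ [-1, 1]ᵏ` (split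
  along the outer regions, rule 1a; invert the large coordinates, rule 2 — every move among
  representations of dimension `k`).

The proofs are those of the Literature file with each base move replaced by its budget form
(`…RealHyperellipticSectorBudgetKit.lean`); the piece machinery (`PeriodCompactify.*`) is reused.

References: J. Viu-Sos, *A semi-canonical reduction for periods of Kontsevich–Zagier*, Int. J.
Number Theory 17 (2021), Thm. 2.1 / Cor. 2.1 [ViuSos2021]; M. Kontsevich, D. Zagier, *Periods*
(2001), §1.2 rules (1), (2) [KontsevichZagier2001]. No definitions are introduced.
-/

noncomputable section

open MeasureTheory Set MvPolynomial
open Literature.ModelTheory.ExponentialFields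
open Literature.NumberTheory.Transcendental Literature.NumberTheory.Transcendental.KZ

namespace Summit.KontsevichZagierPeriods.AbelContraction.RealHyperellipticSector.Port

namespace Kit

variable {k d : ℕ}

/-! ## Generalities inside a budget: termwise sums, null modifications, almost-partitions -/

/-- Finite sums of truncated relations, termwise: if `cᵢ − dᵢ ∈ relationsLE d` for `i ∈ s` then
`∑ cᵢ − ∑ dᵢ ∈ relationsLE d` (inside the budget `relationsLE d`). [folklore] -/
theorem sum_sub_sum_mem_relationsLE {ι : Type*} (s : Finset ι) (c e : ι → FormalRep)
    (h : ∀ i ∈ s, c i - e i ∈ relationsLE d) : ∑ i ∈ s, c i - ∑ i ∈ s, e i ∈ relationsLE d := by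
  rw [← Finset.sum_sub_distrib]
  exact sum_mem h

/-- **Null modifications are truncated relations.** Two representations of dimension `k ≤ d` whose
domains differ by Lebesgue-null sets and whose integrands agree on the common part of the domains
differ by an element of `relationsLE d` (rule 1a among representations of dimension `k`)
(inside the budget `relationsLE d`). [cite: KontsevichZagier2001, §1.2 rule (1)] -/
theorem of_sub_of_mem_relationsLE_of_null (hk : k ≤ d) (r r' : IntegralRep k)
    (h₁ : volume (r.domain \ r'.domain) = 0) (h₂ : volume (r'.domain \ r.domain) = 0)
    (hint : EqOn r.integrand r'.integrand (r.domain ∩ r'.domain)) :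
    of r - of r' ∈ relationsLE d := by
  have hI : IsSemialgebraic ℚ (r.domain ∩ r'.domain) :=
    r.isSemialgebraic_domain.inter r'.isSemialgebraic_domain
  have hI' : IsSemialgebraic ℚ (r'.domain ∩ r.domain) :=
    r'.isSemialgebraic_domain.inter r.isSemialgebraic_domain
  have e1 : of r - of (r.restrict _ hI inter_subset_left) ∈ relationsLE d :=
    Budget.of_sub_of_restrict_mem_relationsLE hk r hI inter_subset_left (by rwa [sdiff_self_inter])
  have e2 : of r' - of (r'.restrict _ hI' inter_subset_left) ∈ relationsLE d :=
    Budget.of_sub_of_restrict_mem_relationsLE hk r' hI' inter_subset_left (by rwa [sdiff_self_inter])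
  have e3 : of (r.restrict _ hI inter_subset_left) - of (r'.restrict _ hI' inter_subset_left) ∈
      relationsLE d :=
    Budget.congr_mem_relationsLE hk (by simp [inter_comm]) (by simpa using hint)
  have : of r - of r' = (of r - of (r.restrict _ hI inter_subset_left)) +
      (of (r.restrict _ hI inter_subset_left) - of (r'.restrict _ hI' inter_subset_left)) -
      (of r' - of (r'.restrict _ hI' inter_subset_left)) := by abel
  rw [this]
  exact (relationsLE d).sub_mem ((relationsLE d).add_mem e1 e3) e2

/-- **Iterated domain additivity over a finite almost-partition, inside a budget.** If the domains
of the `Rᵢ` (`i ∈ s`, dimension `k ≤ d`) lie in the domain of `r` up to null sets, pairwise meet in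
null sets, cover the domain of `r` up to a null set, and carry the integrand of `r` on the overlaps,
then `[r] − ∑ᵢ [Rᵢ] ∈ relationsLE d` (rule 1a among representations of dimension `k`)
(inside the budget `relationsLE d`). [cite: KontsevichZagier2001, §1.2 rule (1)] -/
theorem of_sub_sum_of_mem_relationsLE (hk : k ≤ d) {ι : Type*} (s : Finset ι) :
    ∀ (r : IntegralRep k) (R : ι → IntegralRep k),
      (∀ i ∈ s, volume ((R i).domain \ r.domain) = 0) →
      (∀ i ∈ s, EqOn (R i).integrand r.integrand ((R i).domain ∩ r.domain)) →
      volume (r.domain \ ⋃ i ∈ s, (R i).domain) = 0 →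
      (s : Set ι).Pairwise (fun i j => volume ((R i).domain ∩ (R j).domain) = 0) →
      of r - ∑ i ∈ s, of (R i) ∈ relationsLE d := by
  classical
  induction s using Finset.induction_on with
  | empty =>
    intro r R _ _ hcov _
    simp only [Finset.notMem_empty, iUnion_of_empty, iUnion_empty, sdiff_empty] at hcov
    simpa using Budget.of_mem_relationsLE_of_volume_eq_zero hk r hcov
  | insert a s ha ih =>
    intro r R hdom hint hcov hdisj
    -- split `r` along the domain of `R a`
    have hA : IsSemialgebraic ℚ (r.domain ∩ (R a).domain) :=
      r.isSemialgebraic_domain.inter (R a).isSemialgebraic_domain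
    have hB : IsSemialgebraic ℚ (r.domain \ (R a).domain) :=
      r.isSemialgebraic_domain.diff (R a).isSemialgebraic_domain
    set r₁ := r.restrict _ hA inter_subset_left with hr₁
    set r₂ := r.restrict _ hB sdiff_subset with hr₂
    have hsplit : of r - of r₁ - of r₂ ∈ relationsLE d :=
      Budget.domainAdd_mem_relationsLE hk (by simp [hr₁, hr₂])
        (by rw [show r₁.domain ∩ r₂.domain = ∅ from
          eq_empty_of_forall_notMem fun x hx => hx.2.2 hx.1.2, measure_empty])
        (fun _ _ => rfl) fun _ _ => rfl
    -- `[r₁] ≡ [R a]`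
    have h₁ : of r₁ - of (R a) ∈ relationsLE d := by
      refine of_sub_of_mem_relationsLE_of_null hk r₁ (R a) ?_ ?_ ?_
      · simp [hr₁, sdiff_eq_empty.mpr inter_subset_right]
      · have : (R a).domain \ r₁.domain = (R a).domain \ r.domain := by
          simp [hr₁]
        rw [this]
        exact hdom a (Finset.mem_insert_self a s)
      · intro x hx
        exact (hint a (Finset.mem_insert_self a s) ⟨hx.2, hx.1.1⟩).symm
    -- the induction hypothesis for `r₂`
    have h₂ : of r₂ - ∑ i ∈ s, of (R i) ∈ relationsLE d := by
      refine ih r₂ R (fun i hi => ?_) (fun i hi => ?_) ?_ ?_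
      · have hsub : (R i).domain \ r₂.domain ⊆ ((R i).domain \ r.domain) ∪
            ((R i).domain ∩ (R a).domain) := by
          intro x hx
          by_cases hxr : x ∈ r.domain
          · exact Or.inr ⟨hx.1, by_contra fun h => hx.2 ⟨hxr, h⟩⟩
          · exact Or.inl ⟨hx.1, hxr⟩
        refine measure_mono_null hsub (measure_union_null (hdom i (Finset.mem_insert_of_mem hi))
          (hdisj (Finset.mem_insert_of_mem hi) (Finset.mem_insert_self a s)
            (fun h => ha (h ▸ hi))))
      · exact fun x hx => hint i (Finset.mem_insert_of_mem hi) ⟨hx.1, hx.2.1⟩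
      · have : r₂.domain \ ⋃ i ∈ s, (R i).domain =
            r.domain \ ⋃ i ∈ insert a s, (R i).domain := by
          rw [Finset.set_biUnion_insert, hr₂, IntegralRep.domain_restrict, sdiff_sdiff_left]
          rfl
        rw [this]
        exact hcov
      · exact hdisj.mono (Finset.coe_subset.mpr (Finset.subset_insert a s))
    rw [Finset.sum_insert ha]
    have : of r - (of (R a) + ∑ i ∈ s, of (R i)) =
        (of r - of r₁ - of r₂) + (of r₁ - of (R a)) + (of r₂ - ∑ i ∈ s, of (R i)) := by abel
    rw [this]
    exact (relationsLE d).add_mem ((relationsLE d).add_mem hsplit h₁) h₂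

/-! ## Step (a): compactification of the domain at the level of moves, inside a budget -/

open PeriodCompactify in
/-- **Step (a) [Viu-Sos 2021, Thm. 2.1 / Cor. 2.1] at the level of moves, inside the budget**
(registered sub-goal of crux stmt-KontsevichZagierPeriods-12475, budget form of
`KZ.exists_sub_sum_bounded_mem_relations`). A representation of KZ's literal rational shape
`r = (σ, p/q)` of dimension `k ≤ d` differs by a truncated relation of `relationsLE d` from the sum
of the `2ᵏ` rational representations `(pieceDom T σ, pieceNum T p q / pieceDen T p q)` of
`PeriodCompactDomain.lean`, whose domains lie in `[-1, 1]ᵏ`: split `σ` along the outer regions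
(rule (1) among representations of dimension `k`; the complement of their union is null) and change
variables by the involutive chart `inv T` on each piece (rule (2) among representations of
dimension `k`) (inside the budget `relationsLE d`). [cite: ViuSos2021, Thm. 2.1 and Cor. 2.1] -/
theorem exists_sub_sum_bounded_mem_relationsLE : ∀ {k d : ℕ}, k ≤ d → ∀ (r : KZ.IntegralRep k),
    r.IsRational → ∃ R : Finset (Fin k) → KZ.IntegralRep k,
      (∀ T, (R T).IsRational ∧ Bornology.IsBounded (R T).domain) ∧
      KZ.of r - ∑ T, KZ.of (R T) ∈ KZ.relationsLE d := by
  intro k d hk r hr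
  obtain ⟨p, q, hq, hpq⟩ := hr
  have hσ := r.isSemialgebraic_domain
  have hint : IntegrableOn (fun y => aeval y p / aeval y q) r.domain :=
    r.integrableOn.congr_fun hpq (IntegralRep.measurableSet_domain_holds r)
  set R : Finset (Fin k) → IntegralRep k := fun T => IntegralRep.ofRational (pieceDom T r.domain)
    (pieceNum T p q) (pieceDen T p q) (isSemialgebraic_pieceDom T hσ) (pieceDen_ne_zero T hq)
    (integrableOn_piece T hσ hq hint) with hR
  refine ⟨R, fun T => ⟨IntegralRep.isRational_ofRational _ _ _ _ _ _, isBounded_pieceDom T⟩, ?_⟩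
  -- the traces of `r` on the outer regions
  have hS : ∀ T, IsSemialgebraic ℚ (r.domain ∩ outer T) := fun T => hσ.inter (isSemialgebraic_outer T)
  set S : Finset (Fin k) → IntegralRep k := fun T => r.restrict _ (hS T) inter_subset_left with hS'
  have e1 : of r - ∑ T, of (S T) ∈ relationsLE d := by
    refine of_sub_sum_of_mem_relationsLE hk Finset.univ r S (fun T _ => ?_) (fun T _ _ _ => rfl) ?_ ?_
    · rw [show (S T).domain \ r.domain = ∅ from sdiff_eq_empty.mpr inter_subset_left, measure_empty]
    · refine measure_mono_null (fun x hx => ?_) volume_compl_iUnion_outer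
      intro hx'
      obtain ⟨T, hT⟩ := mem_iUnion.1 hx'
      exact hx.2 (mem_biUnion (Finset.mem_univ T) ⟨hx.1, hT⟩)
    · intro T hT T' hT' hne
      rw [show (S T).domain ∩ (S T').domain = ∅ from
        Set.disjoint_iff_inter_eq_empty.mp (pairwiseDisjoint_outer r.domain hT hT' hne), measure_empty]
  -- each chart is a change-of-variables move among representations of dimension `k`
  have e2 : ∀ T, of (R T) - of (S T) ∈ relationsLE d := fun T =>
    Budget.changeOfVariables_mem_relationsLE hk (inv T) (invDeriv T)
      (isSemialgebraicMapOn_inv_pieceDom T hσ) (hasFDerivWithinAt_inv_pieceDom T)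
      (injOn_inv_pieceDom T) (image_inv_pieceDom T).symm fun v hv => by
        rw [hS', IntegralRep.integrand_restrict, hpq (show inv T v ∈ r.domain from hv.2), hR,
          IntegralRep.integrand_ofRational, mul_comm]
        exact (integrand_piece_eq T hq hv).symm
  have e3 := sum_sub_sum_mem_relationsLE Finset.univ _ _ fun T _ => e2 T
  have : of r - ∑ T, of (R T) = (of r - ∑ T, of (S T)) - (∑ T, of (R T) - ∑ T, of (S T)) := by abel
  rw [this]
  exact (relationsLE d).sub_mem e1 e3

end Kit

end Summit.KontsevichZagierPeriods.AbelContraction.RealHyperellipticSector.Port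

end
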